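import Summits.BirchSwinnertonDyer.BirchSwinnertonDyer.Theorems.SylvesterTwoHeegnerIndexUpperConeOfPrintExactByName
import Summits.BirchSwinnertonDyer.BirchSwinnertonDyer.Theorems.SylvesterTwoHeegnerIndexHSYPointLower
import HarnessLib

/-!
# Route `SylvesterTwoHeegnerIndex` (rung K7t): the LOWER cruxes 19891 `LowerOnV0HSY` / 19892 `LowerOffV0HSY` BY NAME from
# EXACTLY their registered research stub types + the NAMED print #19, and the rung leaf `X12.CMAtTwo` from
# `PublishedFactsTwoPlus` + the named prints {(G3′), #19, #20, VII} + those four stub types — the kernel census of K7t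

Seat `leafhand-bsd-sylvestertwoheegne-1` g0 (prover; priority18 refill D-0181(3) step 4; director-bsd (685) rails:
LAND-ONLY, `--supports stmt-BirchSwinnertonDyer-19891 --as helper`).  THEOREMS ONLY: compositions of landed theorems; no
definition, no named fact, no instance, no notation, no `sorry`.

WHAT THIS FILE IS.  The skeletons of record of the two LOWER cruxes (`Cruxes/LowerOnV0HSY/Lines/hsyPoint_variantP.lean`
afd11512dbb8f877, `Cruxes/LowerOffV0HSY/Lines/hsyPoint_variantP.lean` 7b16d8befe640b13; planner g23/g33) compose each crux
from the PRINT stub `stub_hsyHeightDisplay : HuShuYin2019.shaAnPair_mul_height_eq_two_zpow_mul_height` and two RESEARCH stubs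
`stub_hsyPointBound_fourModNine` / `stub_hsyPointBound_sevenModNine` (point-divisibility bounds on Hu–Shu–Yin's Heegner point:
on `𝒱₀` «`2`-primitive» / «not in `4·E_p(K)+tors`», off `𝒱₀` «`2^j ∣ Y ⟹ i + 2j ≤ s_B + s_A`»), through k7t-c2 g9's
`SylvesterTwoYinLower.lowerOnV0HSY_iff_pointBoundOnV0` / `lowerOffV0HSY_iff_pointBoundOffV0` (`.mpr`) and the residue split.
This file RUNS those compositions on the Theorems side, sorry-free, with the research stubs DISPLAYED as hypotheses (their
registered types VERBATIM) and the print stub in the NAMED currency #19 `shaAnPair_mul_height_eq_two_zpow_mul_height_named`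
(already a hypothesis of the whole UPPER cone; projection `shaAnPair_mul_height_eq_two_zpow_mul_height_of_named`):

* §1 `lowerOnV0HSY_of_named_of_pointBounds` (crux 19891 BY NAME ⟸ #19 + its two stub types),
  `lowerOffV0HSY_of_named_of_pointBounds` (crux 19892 BY NAME ⟸ #19 + its two stub types),
  `heegnerIndexLowerAtTwoHSYOfFacts_of_named_of_pointBounds` (LOWER 19477 BY NAME, via k7t-c3's glue term
  `SylvesterTwoLowerSplit.lowerOfFacts_of_onV0_of_offV0`, p471972 — the term that closed glue 19893);
* §2 ★ `cmAtTwo_of_publishedFactsTwoPlus_of_named_of_pointBounds` — the RUNG LEAF `X12.CMAtTwo` through the route's deciding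
  theorem `Theses.SylvesterTwoHeegnerIndex.closes`, from `PublishedFactsTwoPlus`, the print-exact NAMED facts {(G3′)
  `exists_deg_eq_six_isS3Invariant`, #19, #20 `Nekovar2007.cmPoint_frobeniusCongruence`, VII `casselsTate_canonical_adjoint`}
  (k7t-c2 g35's `SylvesterTwoUpperConePrintExact.heegnerIndexUpperAtTwoHSYOfFactsPlus_of_named`) and the FOUR registered LOWER
  research stub types — nothing else.

READING OF RECORD (kernel-checked here): rung K7t ⟸ PRINT {`PublishedFactsTwoPlus`; (G3′), #19, #20, VII} + RESEARCH {the four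
point-divisibility bounds (lowP-on-4), (lowP-on-7), (lowP-off-4), (lowP-off-7) on Hu–Shu–Yin's Heegner point} — the research
content of the whole rung is the 2-adic divisibility of ONE explicit Heegner point, lower direction (main-conjecture half of
BSD₂ on the Sylvester family; OPEN as a class: no mechanism at the inert prime `2` for `ℤ[ω]`-CM in print).

HONEST LABEL: CONDITIONAL theorems — every print input and every research stub is DISPLAYED as a hypothesis, none is proved
here; no ledger item is closed by this file; `X12.CMAtTwo` is NOT proved; BSD is proved for no curve.

## References
* Y. Hu, J. Shu, H. Yin, Trans. AMS 372 (2019) = arXiv:1708.05266: Thm. 1.4, Cor. 4.4, display (bsd) p. 12, Prop. 2.1 (1), §4.1.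
  [HuShuYin2019]
* R. L. Miller, LMS J. Comput. Math. 14 (2011), Def. 1.1. [Miller2011LMS]
* J. Nekovář (2007), Prop. 4.9 [Nekovar2007]; T. Fisher, JNT 98 (2003), Prop. 2.16 [Fisher2003]; J. S. Milne, ADT (2006),
  I §6 [MilneADT2006]; B. H. Gross, D. Zagier, Invent. Math. 84 (1986) [GrossZagier1986]; V. A. Kolyvagin (1990) [Kolyvagin1990].
-/

set_option linter.dupNamespace false -- Summits modules are `Summit.<Summit>.<Problem>…` by design
set_option autoImplicit false

noncomputable section

open scoped Classical

open WeierstrassCurve WeierstrassCurve.Affine WeierstrassCurve.Affine.Point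
open Literature.NumberTheory.EllipticCurves Literature.NumberTheory.EllipticCurves.ModularForms
  Literature.NumberTheory.EllipticCurves.HuShuYin2019
open Summit.BirchSwinnertonDyer.BirchSwinnertonDyer.Theses.SylvesterTwoHeegnerIndex
open Summit.BirchSwinnertonDyer.BirchSwinnertonDyer.Theorems
  Summit.BirchSwinnertonDyer.BirchSwinnertonDyer.Theorems.SylvesterTwoUpperConePrintExact

namespace Summit.BirchSwinnertonDyer.BirchSwinnertonDyer.Theorems.SylvesterTwoRungCensus

/-! ## §1 The LOWER cruxes BY NAME from #19 and their registered research stub types -/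

/-- **Crux 19891 `LowerOnV0HSY` BY NAME from the NAMED print #19 and EXACTLY the two registered research stub types of its
skeleton of record** (`stub_hsyPointBound_fourModNine`, `stub_hsyPointBound_sevenModNine` of
`Cruxes/LowerOnV0HSY/Lines/hsyPoint_variantP.lean` afd11512dbb8f877, displayed verbatim as `h4`, `h7`): the skeleton's own
composition (`lowerOnV0HSY_iff_pointBoundOnV0 … |>.mpr` + residue split) with the print stub fed by #19 through
`shaAnPair_mul_height_eq_two_zpow_mul_height_of_named`.  CONDITIONAL; the two research stubs are OPEN; closes nothing;
BSD is proved for no curve. [cite: HuShuYin2019, display (bsd) p. 12 with Cor. 4.4] [cite: Miller2011LMS, Def. 1.1] -/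
theorem lowerOnV0HSY_of_named_of_pointBounds (hD : shaAnPair_mul_height_eq_two_zpow_mul_height_named)
    (h4 : PublishedFactsTwo → ∀ (p : ℕ), p.Prime → p % 9 = 4 →
        (¬ ∃ x : ZMod p, x ^ 3 = 3) →
        ∀ (A B : WeierstrassCurve ℚ) [A.IsElliptic] [A.IsGloballyMinimal] [B.IsElliptic]
          [B.IsGloballyMinimal], (∃ C : VariableChange ℚ, C • B = cubeSumCurve (p : ℚ)) →
          (∃ C : VariableChange ℚ, C • A = cubeSumCurve (3 * (p : ℚ) ^ 2)) →
          (Nat.card (AddCommGroup.primaryComponent B.sha 2) = 1 ∧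
            Nat.card (AddCommGroup.primaryComponent A.sha 2) = 1) →
          ∀ (qB qA : ℚ), shaAn B = (qB : ℂ) → shaAn A = (qA : ℂ) →
          ∀ (K : Type) [Field K] [NumberField K] (ω : K), ω ^ 2 + ω + 1 = 0 → Module.finrank ℚ K = 2 →
          ∀ (P₀ : B.toAffine.Point), ¬ IsOfFinAddOrder (QuadraticDescent.incl K B P₀) →
            (∀ Q : B.toAffine.Point, ∃ m : ℤ,
              IsOfFinAddOrder (QuadraticDescent.incl K B Q - m • QuadraticDescent.incl K B P₀)) →
          ∀ (Y : (B.baseChange K).toAffine.Point),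
            ((qB * qA : ℚ) : ℝ) * canonicalHeight (QuadraticDescent.incl K B P₀) =
              (2 : ℝ) ^ (if p % 9 = 4 then (0 : ℤ) else -2) * canonicalHeight Y →
          ∀ j : ℕ, (∃ Y' T' : (B.baseChange K).toAffine.Point,
              IsOfFinAddOrder T' ∧ Y = ((2 : ℤ) ^ j) • Y' + T') →
            (if p % 9 = 4 then (0 : ℤ) else -2) + 2 * (j : ℤ) ≤ 0)
    (h7 : PublishedFactsTwo → ∀ (p : ℕ), p.Prime → p % 9 = 7 →
        (¬ ∃ x : ZMod p, x ^ 3 = 3) →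
        ∀ (A B : WeierstrassCurve ℚ) [A.IsElliptic] [A.IsGloballyMinimal] [B.IsElliptic]
          [B.IsGloballyMinimal], (∃ C : VariableChange ℚ, C • B = cubeSumCurve (p : ℚ)) →
          (∃ C : VariableChange ℚ, C • A = cubeSumCurve (3 * (p : ℚ) ^ 2)) →
          (Nat.card (AddCommGroup.primaryComponent B.sha 2) = 1 ∧
            Nat.card (AddCommGroup.primaryComponent A.sha 2) = 1) →
          ∀ (qB qA : ℚ), shaAn B = (qB : ℂ) → shaAn A = (qA : ℂ) →
          ∀ (K : Type) [Field K] [NumberField K] (ω : K), ω ^ 2 + ω + 1 = 0 → Module.finrank ℚ K = 2 →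
          ∀ (P₀ : B.toAffine.Point), ¬ IsOfFinAddOrder (QuadraticDescent.incl K B P₀) →
            (∀ Q : B.toAffine.Point, ∃ m : ℤ,
              IsOfFinAddOrder (QuadraticDescent.incl K B Q - m • QuadraticDescent.incl K B P₀)) →
          ∀ (Y : (B.baseChange K).toAffine.Point),
            ((qB * qA : ℚ) : ℝ) * canonicalHeight (QuadraticDescent.incl K B P₀) =
              (2 : ℝ) ^ (if p % 9 = 4 then (0 : ℤ) else -2) * canonicalHeight Y →
          ∀ j : ℕ, (∃ Y' T' : (B.baseChange K).toAffine.Point,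
              IsOfFinAddOrder T' ∧ Y = ((2 : ℤ) ^ j) • Y' + T') →
            (if p % 9 = 4 then (0 : ℤ) else -2) + 2 * (j : ℤ) ≤ 0) :
    Summit.BirchSwinnertonDyer.BirchSwinnertonDyer.Theses.SylvesterTwoHeegnerIndex.LowerOnV0HSY :=
  (SylvesterTwoYinLower.lowerOnV0HSY_iff_pointBoundOnV0
      (shaAnPair_mul_height_eq_two_zpow_mul_height_of_named hD)).mpr
    (fun hF p hp h9 h3 A B _ _ _ _ hB hA hV =>
      h9.elim (fun hp4 => h4 hF p hp hp4 h3 A B hB hA hV) (fun hp7 => h7 hF p hp hp7 h3 A B hB hA hV))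

/-- **Crux 19892 `LowerOffV0HSY` BY NAME from the NAMED print #19 and EXACTLY the two registered research stub types of its
skeleton of record** (`Cruxes/LowerOffV0HSY/Lines/hsyPoint_variantP.lean` 7b16d8befe640b13; displayed verbatim as `h4`, `h7`).
CONDITIONAL; the two research stubs are OPEN; closes nothing; BSD is proved for no curve.
[cite: HuShuYin2019, display (bsd) p. 12 with Cor. 4.4] [cite: Miller2011LMS, Def. 1.1] -/
theorem lowerOffV0HSY_of_named_of_pointBounds (hD : shaAnPair_mul_height_eq_two_zpow_mul_height_named)
    (h4 : PublishedFactsTwo → ∀ (p : ℕ), p.Prime → p % 9 = 4 →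
        (¬ ∃ x : ZMod p, x ^ 3 = 3) →
        ∀ (A B : WeierstrassCurve ℚ) [A.IsElliptic] [A.IsGloballyMinimal] [B.IsElliptic]
          [B.IsGloballyMinimal], (∃ C : VariableChange ℚ, C • B = cubeSumCurve (p : ℚ)) →
          (∃ C : VariableChange ℚ, C • A = cubeSumCurve (3 * (p : ℚ) ^ 2)) →
          ¬ (Nat.card (AddCommGroup.primaryComponent B.sha 2) = 1 ∧
            Nat.card (AddCommGroup.primaryComponent A.sha 2) = 1) →
          ∀ (qB qA : ℚ), shaAn B = (qB : ℂ) → shaAn A = (qA : ℂ) →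
          ∀ (K : Type) [Field K] [NumberField K] (ω : K), ω ^ 2 + ω + 1 = 0 → Module.finrank ℚ K = 2 →
          ∀ (P₀ : B.toAffine.Point), ¬ IsOfFinAddOrder (QuadraticDescent.incl K B P₀) →
            (∀ Q : B.toAffine.Point, ∃ m : ℤ,
              IsOfFinAddOrder (QuadraticDescent.incl K B Q - m • QuadraticDescent.incl K B P₀)) →
          ∀ (Y : (B.baseChange K).toAffine.Point),
            ((qB * qA : ℚ) : ℝ) * canonicalHeight (QuadraticDescent.incl K B P₀) =
              (2 : ℝ) ^ (if p % 9 = 4 then (0 : ℤ) else -2) * canonicalHeight Y →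
          ∀ j : ℕ, (∃ Y' T' : (B.baseChange K).toAffine.Point,
              IsOfFinAddOrder T' ∧ Y = ((2 : ℤ) ^ j) • Y' + T') →
            (if p % 9 = 4 then (0 : ℤ) else -2) + 2 * (j : ℤ) ≤
              (padicValNat 2 (Nat.card (AddCommGroup.primaryComponent B.sha 2)) : ℤ) +
                (padicValNat 2 (Nat.card (AddCommGroup.primaryComponent A.sha 2)) : ℤ))
    (h7 : PublishedFactsTwo → ∀ (p : ℕ), p.Prime → p % 9 = 7 →
        (¬ ∃ x : ZMod p, x ^ 3 = 3) →
        ∀ (A B : WeierstrassCurve ℚ) [A.IsElliptic] [A.IsGloballyMinimal] [B.IsElliptic]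
          [B.IsGloballyMinimal], (∃ C : VariableChange ℚ, C • B = cubeSumCurve (p : ℚ)) →
          (∃ C : VariableChange ℚ, C • A = cubeSumCurve (3 * (p : ℚ) ^ 2)) →
          ¬ (Nat.card (AddCommGroup.primaryComponent B.sha 2) = 1 ∧
            Nat.card (AddCommGroup.primaryComponent A.sha 2) = 1) →
          ∀ (qB qA : ℚ), shaAn B = (qB : ℂ) → shaAn A = (qA : ℂ) →
          ∀ (K : Type) [Field K] [NumberField K] (ω : K), ω ^ 2 + ω + 1 = 0 → Module.finrank ℚ K = 2 →
          ∀ (P₀ : B.toAffine.Point), ¬ IsOfFinAddOrder (QuadraticDescent.incl K B P₀) →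
            (∀ Q : B.toAffine.Point, ∃ m : ℤ,
              IsOfFinAddOrder (QuadraticDescent.incl K B Q - m • QuadraticDescent.incl K B P₀)) →
          ∀ (Y : (B.baseChange K).toAffine.Point),
            ((qB * qA : ℚ) : ℝ) * canonicalHeight (QuadraticDescent.incl K B P₀) =
              (2 : ℝ) ^ (if p % 9 = 4 then (0 : ℤ) else -2) * canonicalHeight Y →
          ∀ j : ℕ, (∃ Y' T' : (B.baseChange K).toAffine.Point,
              IsOfFinAddOrder T' ∧ Y = ((2 : ℤ) ^ j) • Y' + T') →
            (if p % 9 = 4 then (0 : ℤ) else -2) + 2 * (j : ℤ) ≤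
              (padicValNat 2 (Nat.card (AddCommGroup.primaryComponent B.sha 2)) : ℤ) +
                (padicValNat 2 (Nat.card (AddCommGroup.primaryComponent A.sha 2)) : ℤ)) :
    Summit.BirchSwinnertonDyer.BirchSwinnertonDyer.Theses.SylvesterTwoHeegnerIndex.LowerOffV0HSY :=
  (SylvesterTwoYinLower.lowerOffV0HSY_iff_pointBoundOffV0
      (shaAnPair_mul_height_eq_two_zpow_mul_height_of_named hD)).mpr
    (fun hF p hp h9 h3 A B _ _ _ _ hB hA hV =>
      h9.elim (fun hp4 => h4 hF p hp hp4 h3 A B hB hA hV) (fun hp7 => h7 hF p hp hp7 h3 A B hB hA hV))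

/-- **LOWER `HeegnerIndexLowerAtTwoHSYOfFacts` (item 19477) BY NAME from #19 and the FOUR registered LOWER research stub types**
(on-`𝒱₀` `hon4`, `hon7`; off-`𝒱₀` `hoff4`, `hoff7`), through k7t-c3's glue term
`SylvesterTwoLowerSplit.lowerOfFacts_of_onV0_of_offV0` (p471972; the term of the closed glue item 19893).  CONDITIONAL; closes nothing; BSD is proved for no curve.
[cite: HuShuYin2019, display (bsd) p. 12 with Cor. 4.4] [cite: Miller2011LMS, Def. 1.1] -/
theorem heegnerIndexLowerAtTwoHSYOfFacts_of_named_of_pointBounds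
    (hD : shaAnPair_mul_height_eq_two_zpow_mul_height_named)
    (hon4 : PublishedFactsTwo → ∀ (p : ℕ), p.Prime → p % 9 = 4 →
        (¬ ∃ x : ZMod p, x ^ 3 = 3) →
        ∀ (A B : WeierstrassCurve ℚ) [A.IsElliptic] [A.IsGloballyMinimal] [B.IsElliptic]
          [B.IsGloballyMinimal], (∃ C : VariableChange ℚ, C • B = cubeSumCurve (p : ℚ)) →
          (∃ C : VariableChange ℚ, C • A = cubeSumCurve (3 * (p : ℚ) ^ 2)) →
          (Nat.card (AddCommGroup.primaryComponent B.sha 2) = 1 ∧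
            Nat.card (AddCommGroup.primaryComponent A.sha 2) = 1) →
          ∀ (qB qA : ℚ), shaAn B = (qB : ℂ) → shaAn A = (qA : ℂ) →
          ∀ (K : Type) [Field K] [NumberField K] (ω : K), ω ^ 2 + ω + 1 = 0 → Module.finrank ℚ K = 2 →
          ∀ (P₀ : B.toAffine.Point), ¬ IsOfFinAddOrder (QuadraticDescent.incl K B P₀) →
            (∀ Q : B.toAffine.Point, ∃ m : ℤ,
              IsOfFinAddOrder (QuadraticDescent.incl K B Q - m • QuadraticDescent.incl K B P₀)) →
          ∀ (Y : (B.baseChange K).toAffine.Point),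
            ((qB * qA : ℚ) : ℝ) * canonicalHeight (QuadraticDescent.incl K B P₀) =
              (2 : ℝ) ^ (if p % 9 = 4 then (0 : ℤ) else -2) * canonicalHeight Y →
          ∀ j : ℕ, (∃ Y' T' : (B.baseChange K).toAffine.Point,
              IsOfFinAddOrder T' ∧ Y = ((2 : ℤ) ^ j) • Y' + T') →
            (if p % 9 = 4 then (0 : ℤ) else -2) + 2 * (j : ℤ) ≤ 0)
    (hon7 : PublishedFactsTwo → ∀ (p : ℕ), p.Prime → p % 9 = 7 →
        (¬ ∃ x : ZMod p, x ^ 3 = 3) →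
        ∀ (A B : WeierstrassCurve ℚ) [A.IsElliptic] [A.IsGloballyMinimal] [B.IsElliptic]
          [B.IsGloballyMinimal], (∃ C : VariableChange ℚ, C • B = cubeSumCurve (p : ℚ)) →
          (∃ C : VariableChange ℚ, C • A = cubeSumCurve (3 * (p : ℚ) ^ 2)) →
          (Nat.card (AddCommGroup.primaryComponent B.sha 2) = 1 ∧
            Nat.card (AddCommGroup.primaryComponent A.sha 2) = 1) →
          ∀ (qB qA : ℚ), shaAn B = (qB : ℂ) → shaAn A = (qA : ℂ) →
          ∀ (K : Type) [Field K] [NumberField K] (ω : K), ω ^ 2 + ω + 1 = 0 → Module.finrank ℚ K = 2 →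
          ∀ (P₀ : B.toAffine.Point), ¬ IsOfFinAddOrder (QuadraticDescent.incl K B P₀) →
            (∀ Q : B.toAffine.Point, ∃ m : ℤ,
              IsOfFinAddOrder (QuadraticDescent.incl K B Q - m • QuadraticDescent.incl K B P₀)) →
          ∀ (Y : (B.baseChange K).toAffine.Point),
            ((qB * qA : ℚ) : ℝ) * canonicalHeight (QuadraticDescent.incl K B P₀) =
              (2 : ℝ) ^ (if p % 9 = 4 then (0 : ℤ) else -2) * canonicalHeight Y →
          ∀ j : ℕ, (∃ Y' T' : (B.baseChange K).toAffine.Point,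
              IsOfFinAddOrder T' ∧ Y = ((2 : ℤ) ^ j) • Y' + T') →
            (if p % 9 = 4 then (0 : ℤ) else -2) + 2 * (j : ℤ) ≤ 0)
    (hoff4 : PublishedFactsTwo → ∀ (p : ℕ), p.Prime → p % 9 = 4 →
        (¬ ∃ x : ZMod p, x ^ 3 = 3) →
        ∀ (A B : WeierstrassCurve ℚ) [A.IsElliptic] [A.IsGloballyMinimal] [B.IsElliptic]
          [B.IsGloballyMinimal], (∃ C : VariableChange ℚ, C • B = cubeSumCurve (p : ℚ)) →
          (∃ C : VariableChange ℚ, C • A = cubeSumCurve (3 * (p : ℚ) ^ 2)) →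
          ¬ (Nat.card (AddCommGroup.primaryComponent B.sha 2) = 1 ∧
            Nat.card (AddCommGroup.primaryComponent A.sha 2) = 1) →
          ∀ (qB qA : ℚ), shaAn B = (qB : ℂ) → shaAn A = (qA : ℂ) →
          ∀ (K : Type) [Field K] [NumberField K] (ω : K), ω ^ 2 + ω + 1 = 0 → Module.finrank ℚ K = 2 →
          ∀ (P₀ : B.toAffine.Point), ¬ IsOfFinAddOrder (QuadraticDescent.incl K B P₀) →
            (∀ Q : B.toAffine.Point, ∃ m : ℤ,
              IsOfFinAddOrder (QuadraticDescent.incl K B Q - m • QuadraticDescent.incl K B P₀)) →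
          ∀ (Y : (B.baseChange K).toAffine.Point),
            ((qB * qA : ℚ) : ℝ) * canonicalHeight (QuadraticDescent.incl K B P₀) =
              (2 : ℝ) ^ (if p % 9 = 4 then (0 : ℤ) else -2) * canonicalHeight Y →
          ∀ j : ℕ, (∃ Y' T' : (B.baseChange K).toAffine.Point,
              IsOfFinAddOrder T' ∧ Y = ((2 : ℤ) ^ j) • Y' + T') →
            (if p % 9 = 4 then (0 : ℤ) else -2) + 2 * (j : ℤ) ≤
              (padicValNat 2 (Nat.card (AddCommGroup.primaryComponent B.sha 2)) : ℤ) +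
                (padicValNat 2 (Nat.card (AddCommGroup.primaryComponent A.sha 2)) : ℤ))
    (hoff7 : PublishedFactsTwo → ∀ (p : ℕ), p.Prime → p % 9 = 7 →
        (¬ ∃ x : ZMod p, x ^ 3 = 3) →
        ∀ (A B : WeierstrassCurve ℚ) [A.IsElliptic] [A.IsGloballyMinimal] [B.IsElliptic]
          [B.IsGloballyMinimal], (∃ C : VariableChange ℚ, C • B = cubeSumCurve (p : ℚ)) →
          (∃ C : VariableChange ℚ, C • A = cubeSumCurve (3 * (p : ℚ) ^ 2)) →
          ¬ (Nat.card (AddCommGroup.primaryComponent B.sha 2) = 1 ∧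
            Nat.card (AddCommGroup.primaryComponent A.sha 2) = 1) →
          ∀ (qB qA : ℚ), shaAn B = (qB : ℂ) → shaAn A = (qA : ℂ) →
          ∀ (K : Type) [Field K] [NumberField K] (ω : K), ω ^ 2 + ω + 1 = 0 → Module.finrank ℚ K = 2 →
          ∀ (P₀ : B.toAffine.Point), ¬ IsOfFinAddOrder (QuadraticDescent.incl K B P₀) →
            (∀ Q : B.toAffine.Point, ∃ m : ℤ,
              IsOfFinAddOrder (QuadraticDescent.incl K B Q - m • QuadraticDescent.incl K B P₀)) →
          ∀ (Y : (B.baseChange K).toAffine.Point),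
            ((qB * qA : ℚ) : ℝ) * canonicalHeight (QuadraticDescent.incl K B P₀) =
              (2 : ℝ) ^ (if p % 9 = 4 then (0 : ℤ) else -2) * canonicalHeight Y →
          ∀ j : ℕ, (∃ Y' T' : (B.baseChange K).toAffine.Point,
              IsOfFinAddOrder T' ∧ Y = ((2 : ℤ) ^ j) • Y' + T') →
            (if p % 9 = 4 then (0 : ℤ) else -2) + 2 * (j : ℤ) ≤
              (padicValNat 2 (Nat.card (AddCommGroup.primaryComponent B.sha 2)) : ℤ) +
                (padicValNat 2 (Nat.card (AddCommGroup.primaryComponent A.sha 2)) : ℤ)) :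
    Summit.BirchSwinnertonDyer.BirchSwinnertonDyer.Theses.SylvesterTwoHeegnerIndex.HeegnerIndexLowerAtTwoHSYOfFacts :=
  SylvesterTwoLowerSplit.lowerOfFacts_of_onV0_of_offV0 (lowerOnV0HSY_of_named_of_pointBounds hD hon4 hon7)
    (lowerOffV0HSY_of_named_of_pointBounds hD hoff4 hoff7)

/-! ## §2 The rung leaf from the prints and the four LOWER research stub types -/

/-- ★ **The RUNG LEAF `X12.CMAtTwo` ⟸ `PublishedFactsTwoPlus` + the print-exact NAMED facts {(G3′)
`exists_deg_eq_six_isS3Invariant`, #19 `shaAnPair_mul_height_eq_two_zpow_mul_height_named`, #20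
`Nekovar2007.cmPoint_frobeniusCongruence`, VII `casselsTate_canonical_adjoint`} + EXACTLY the FOUR registered LOWER research
stub types** — through the route's deciding theorem `Theses.SylvesterTwoHeegnerIndex.closes`, with UPPER 19725 by k7t-c2 g35's
`heegnerIndexUpperAtTwoHSYOfFactsPlus_of_named` and LOWER 19477 by §1.  The kernel census of rung K7t: modulo prints, its
research content is the four point-divisibility bounds on Hu–Shu–Yin's Heegner point (main-conjecture half of BSD₂ on the
Sylvester family), nothing else.  CONDITIONAL; `X12.CMAtTwo` is NOT proved; closes no ledger item; BSD is proved for no curve.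
[cite: HuShuYin2019, Thm. 1.4, Cor. 4.4, display (bsd) p. 12, Prop. 2.1 (1), §4.1] [cite: Nekovar2007, Prop. 4.9]
[cite: Fisher2003, Prop. 2.16 (JNT 98, p. 132)] [cite: MilneADT2006, Ch. I §6 Prop. 6.9, Thm. 6.13(a)]
[cite: GrossZagier1986, I (6.5), V §2] [cite: Kolyvagin1990, Thm. A] [cite: Miller2011LMS, Def. 1.1] -/
theorem cmAtTwo_of_publishedFactsTwoPlus_of_named_of_pointBounds
    (hF : Summit.BirchSwinnertonDyer.BirchSwinnertonDyer.Theses.SylvesterTwoHeegnerIndex.PublishedFactsTwoPlus)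
    (hG3' : exists_deg_eq_six_isS3Invariant) (hD : shaAnPair_mul_height_eq_two_zpow_mul_height_named)
    (hES2 : Nekovar2007.cmPoint_frobeniusCongruence)
    (hVII : ∀ (K : Type) [Field K] [NumberField K] (σ₀ : K ≃ₐ[ℚ] K) (h2 : Module.finrank ℚ K = 2) (hσ₀ : σ₀ ≠ 1),
      casselsTate_canonical_adjoint K σ₀ h2 hσ₀)
    (hon4 : PublishedFactsTwo → ∀ (p : ℕ), p.Prime → p % 9 = 4 →
        (¬ ∃ x : ZMod p, x ^ 3 = 3) →
        ∀ (A B : WeierstrassCurve ℚ) [A.IsElliptic] [A.IsGloballyMinimal] [B.IsElliptic]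
          [B.IsGloballyMinimal], (∃ C : VariableChange ℚ, C • B = cubeSumCurve (p : ℚ)) →
          (∃ C : VariableChange ℚ, C • A = cubeSumCurve (3 * (p : ℚ) ^ 2)) →
          (Nat.card (AddCommGroup.primaryComponent B.sha 2) = 1 ∧
            Nat.card (AddCommGroup.primaryComponent A.sha 2) = 1) →
          ∀ (qB qA : ℚ), shaAn B = (qB : ℂ) → shaAn A = (qA : ℂ) →
          ∀ (K : Type) [Field K] [NumberField K] (ω : K), ω ^ 2 + ω + 1 = 0 → Module.finrank ℚ K = 2 →
          ∀ (P₀ : B.toAffine.Point), ¬ IsOfFinAddOrder (QuadraticDescent.incl K B P₀) →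
            (∀ Q : B.toAffine.Point, ∃ m : ℤ,
              IsOfFinAddOrder (QuadraticDescent.incl K B Q - m • QuadraticDescent.incl K B P₀)) →
          ∀ (Y : (B.baseChange K).toAffine.Point),
            ((qB * qA : ℚ) : ℝ) * canonicalHeight (QuadraticDescent.incl K B P₀) =
              (2 : ℝ) ^ (if p % 9 = 4 then (0 : ℤ) else -2) * canonicalHeight Y →
          ∀ j : ℕ, (∃ Y' T' : (B.baseChange K).toAffine.Point,
              IsOfFinAddOrder T' ∧ Y = ((2 : ℤ) ^ j) • Y' + T') →
            (if p % 9 = 4 then (0 : ℤ) else -2) + 2 * (j : ℤ) ≤ 0)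
    (hon7 : PublishedFactsTwo → ∀ (p : ℕ), p.Prime → p % 9 = 7 →
        (¬ ∃ x : ZMod p, x ^ 3 = 3) →
        ∀ (A B : WeierstrassCurve ℚ) [A.IsElliptic] [A.IsGloballyMinimal] [B.IsElliptic]
          [B.IsGloballyMinimal], (∃ C : VariableChange ℚ, C • B = cubeSumCurve (p : ℚ)) →
          (∃ C : VariableChange ℚ, C • A = cubeSumCurve (3 * (p : ℚ) ^ 2)) →
          (Nat.card (AddCommGroup.primaryComponent B.sha 2) = 1 ∧
            Nat.card (AddCommGroup.primaryComponent A.sha 2) = 1) →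
          ∀ (qB qA : ℚ), shaAn B = (qB : ℂ) → shaAn A = (qA : ℂ) →
          ∀ (K : Type) [Field K] [NumberField K] (ω : K), ω ^ 2 + ω + 1 = 0 → Module.finrank ℚ K = 2 →
          ∀ (P₀ : B.toAffine.Point), ¬ IsOfFinAddOrder (QuadraticDescent.incl K B P₀) →
            (∀ Q : B.toAffine.Point, ∃ m : ℤ,
              IsOfFinAddOrder (QuadraticDescent.incl K B Q - m • QuadraticDescent.incl K B P₀)) →
          ∀ (Y : (B.baseChange K).toAffine.Point),
            ((qB * qA : ℚ) : ℝ) * canonicalHeight (QuadraticDescent.incl K B P₀) =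
              (2 : ℝ) ^ (if p % 9 = 4 then (0 : ℤ) else -2) * canonicalHeight Y →
          ∀ j : ℕ, (∃ Y' T' : (B.baseChange K).toAffine.Point,
              IsOfFinAddOrder T' ∧ Y = ((2 : ℤ) ^ j) • Y' + T') →
            (if p % 9 = 4 then (0 : ℤ) else -2) + 2 * (j : ℤ) ≤ 0)
    (hoff4 : PublishedFactsTwo → ∀ (p : ℕ), p.Prime → p % 9 = 4 →
        (¬ ∃ x : ZMod p, x ^ 3 = 3) →
        ∀ (A B : WeierstrassCurve ℚ) [A.IsElliptic] [A.IsGloballyMinimal] [B.IsElliptic]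
          [B.IsGloballyMinimal], (∃ C : VariableChange ℚ, C • B = cubeSumCurve (p : ℚ)) →
          (∃ C : VariableChange ℚ, C • A = cubeSumCurve (3 * (p : ℚ) ^ 2)) →
          ¬ (Nat.card (AddCommGroup.primaryComponent B.sha 2) = 1 ∧
            Nat.card (AddCommGroup.primaryComponent A.sha 2) = 1) →
          ∀ (qB qA : ℚ), shaAn B = (qB : ℂ) → shaAn A = (qA : ℂ) →
          ∀ (K : Type) [Field K] [NumberField K] (ω : K), ω ^ 2 + ω + 1 = 0 → Module.finrank ℚ K = 2 →
          ∀ (P₀ : B.toAffine.Point), ¬ IsOfFinAddOrder (QuadraticDescent.incl K B P₀) →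
            (∀ Q : B.toAffine.Point, ∃ m : ℤ,
              IsOfFinAddOrder (QuadraticDescent.incl K B Q - m • QuadraticDescent.incl K B P₀)) →
          ∀ (Y : (B.baseChange K).toAffine.Point),
            ((qB * qA : ℚ) : ℝ) * canonicalHeight (QuadraticDescent.incl K B P₀) =
              (2 : ℝ) ^ (if p % 9 = 4 then (0 : ℤ) else -2) * canonicalHeight Y →
          ∀ j : ℕ, (∃ Y' T' : (B.baseChange K).toAffine.Point,
              IsOfFinAddOrder T' ∧ Y = ((2 : ℤ) ^ j) • Y' + T') →
            (if p % 9 = 4 then (0 : ℤ) else -2) + 2 * (j : ℤ) ≤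
              (padicValNat 2 (Nat.card (AddCommGroup.primaryComponent B.sha 2)) : ℤ) +
                (padicValNat 2 (Nat.card (AddCommGroup.primaryComponent A.sha 2)) : ℤ))
    (hoff7 : PublishedFactsTwo → ∀ (p : ℕ), p.Prime → p % 9 = 7 →
        (¬ ∃ x : ZMod p, x ^ 3 = 3) →
        ∀ (A B : WeierstrassCurve ℚ) [A.IsElliptic] [A.IsGloballyMinimal] [B.IsElliptic]
          [B.IsGloballyMinimal], (∃ C : VariableChange ℚ, C • B = cubeSumCurve (p : ℚ)) →
          (∃ C : VariableChange ℚ, C • A = cubeSumCurve (3 * (p : ℚ) ^ 2)) →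
          ¬ (Nat.card (AddCommGroup.primaryComponent B.sha 2) = 1 ∧
            Nat.card (AddCommGroup.primaryComponent A.sha 2) = 1) →
          ∀ (qB qA : ℚ), shaAn B = (qB : ℂ) → shaAn A = (qA : ℂ) →
          ∀ (K : Type) [Field K] [NumberField K] (ω : K), ω ^ 2 + ω + 1 = 0 → Module.finrank ℚ K = 2 →
          ∀ (P₀ : B.toAffine.Point), ¬ IsOfFinAddOrder (QuadraticDescent.incl K B P₀) →
            (∀ Q : B.toAffine.Point, ∃ m : ℤ,
              IsOfFinAddOrder (QuadraticDescent.incl K B Q - m • QuadraticDescent.incl K B P₀)) →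
          ∀ (Y : (B.baseChange K).toAffine.Point),
            ((qB * qA : ℚ) : ℝ) * canonicalHeight (QuadraticDescent.incl K B P₀) =
              (2 : ℝ) ^ (if p % 9 = 4 then (0 : ℤ) else -2) * canonicalHeight Y →
          ∀ j : ℕ, (∃ Y' T' : (B.baseChange K).toAffine.Point,
              IsOfFinAddOrder T' ∧ Y = ((2 : ℤ) ^ j) • Y' + T') →
            (if p % 9 = 4 then (0 : ℤ) else -2) + 2 * (j : ℤ) ≤
              (padicValNat 2 (Nat.card (AddCommGroup.primaryComponent B.sha 2)) : ℤ) +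
                (padicValNat 2 (Nat.card (AddCommGroup.primaryComponent A.sha 2)) : ℤ)) :
    Summit.BirchSwinnertonDyer.Rank1Residual.X12.CMAtTwo :=
  Summit.BirchSwinnertonDyer.BirchSwinnertonDyer.Theses.SylvesterTwoHeegnerIndex.closes
    (heegnerIndexLowerAtTwoHSYOfFacts_of_named_of_pointBounds hD hon4 hon7 hoff4 hoff7)
    (heegnerIndexUpperAtTwoHSYOfFactsPlus_of_named hG3' hD hES2 hVII) hF

end Summit.BirchSwinnertonDyer.BirchSwinnertonDyer.Theorems.SylvesterTwoRungCensus

end
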